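import Summits.BirchSwinnertonDyer.Rank1Residual.X4.HeckeTransformCommute
import HarnessLib

/-!
# The DERIVATIVE FAMILY `U ↦ d_U γ` generated by one periodic function: well defined on finite sets of primes, periodic, satisfies `H_q (d_U γ) = 2·d_U γ + d_{U∪q} γ`, linear in `γ` (cell `b2b-bsdres`, seat additive-p4 gen 30, line V51′ — second brick of lemma S)

HONEST FRAMING (verbatim, cell `b2b-bsdres`): the goal of the cell is to DELETE the COMBINATION-SHAPED
residual classes for ALL analytic-rank `≤ 1` curves over `ℚ` — "full BSD formula for every rank `≤ 1`
curve in class `C`" assembled STRICTLY from published theorems — so that the rank-`≤ 1` remainder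
becomes exactly the CONSTRUCTION-SHAPED classes, which are TYPED (missing-input Props), NOT attempted;
this is not "finishing BSD". This file: research-route KERNEL LEMMAS (pure algebra; no named fact, no
conjecture, nothing booked; X4 stays CONSTRUCTION-SHAPED).

## What is proved (and why)

Lemma S of the two-prime additivity theorem (`X4/KuriharaAdditiveLevelLowering.lean`, hypotheses
`G`, `hDG`, `hS`) asks for a DERIVATIVE FAMILY — `G : Finset ℕ → (ℚ → R)` with
`H_q (G U) = 2·G U + G (U ∪ {q})` — with prescribed Kurihara numbers. The witness will be
`G U = d_U γ = (∏_{q ∈ U} d_q) γ` for an explicit `γ`; this file builds that family for ANY periodic `γ`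
and proves it is a derivative family:

* `derivFamilyList l γ` — iterate `d_q` (`heckeDeriv`) along a list; `derivFamily γ U` — along the
  sorted list of `U`.
* `derivFamilyList_perm` — for a periodic `γ` and a duplicate-free list of primes the result does not
  depend on the order (`heckeDeriv_comm`); `derivFamily_insert` — `d_{U ∪ {q}} γ = d_q (d_U γ)`.
* **`heckeTransform_derivFamily`** — the derivative-family relation
  `H_q (d_U γ) = 2·d_U γ + d_{U∪{q}} γ` (`q` prime, `q ∉ U`, `U` a set of primes): the shape of the
  hypotheses `hD`/`hDG` in `X4/KuriharaLevelLoweringDescentDefect.lean` and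
  `X4/KuriharaAdditiveLevelLowering.lean`.
* `IsPeriodic.derivFamily`, `derivFamily_add`, `derivFamily_sub`, `derivFamily_const_mul` — periodicity
  and linearity in `γ` (the assembly of lemma S adds test functions level by level).

## References

* B. Mazur, J. Tate, J. Teitelbaum, Invent. Math. 84 (1986), §I.4 (4.2). [cite: MazurTateTeitelbaum1986Invent, §I.4 (4.2)]
-/

noncomputable section

open scoped MatrixGroups ModularForm

open CongruenceSubgroup Finset

open Literature.NumberTheory.EllipticCurves Literature.NumberTheory.EllipticCurves.ModularForms

namespace Summit.BirchSwinnertonDyer.Rank1Residual.LevelLowering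

variable {R : Type*} [CommRing R]

/-! ### §1 Iterated Hecke derivatives along a list -/

/-- Iterate the Hecke derivatives `d_q` along a list of primes: `d_{[q₁,…,q_k]} γ = d_{q₁}(d_{q₂}(⋯ γ))`.
[cite: MazurTateTeitelbaum1986Invent, §I.4 (4.2)] -/
def derivFamilyList : List ℕ → (ℚ → R) → (ℚ → R)
  | [], γ => γ
  | q :: l, γ => heckeDeriv q (derivFamilyList l γ)

/-- Unfolding on a cons. [folklore] -/
theorem derivFamilyList_cons (q : ℕ) (l : List ℕ) (γ : ℚ → R) :
    derivFamilyList (q :: l) γ = heckeDeriv q (derivFamilyList l γ) := rfl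

/-- Periodicity is preserved along a list of positive integers. [folklore] -/
theorem IsPeriodic.derivFamilyList {γ : ℚ → R} (hγ : IsPeriodic γ) :
    ∀ l : List ℕ, (∀ q ∈ l, 0 < q) → IsPeriodic (derivFamilyList l γ)
  | [], _ => hγ
  | q :: l, hl => by
    rw [derivFamilyList_cons]
    exact (IsPeriodic.derivFamilyList hγ l fun x hx ↦ hl x (List.mem_cons_of_mem q hx)).heckeDeriv
      (hl q (List.mem_cons_self))

/-- **Order independence**: for a periodic `γ` and duplicate-free lists of primes that are permutations
of each other, the iterated derivatives agree (`heckeDeriv_comm`). [folklore] -/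
theorem derivFamilyList_perm {γ : ℚ → R} (hγ : IsPeriodic γ) {l l' : List ℕ} (h : l.Perm l')
    (hp : ∀ q ∈ l, q.Prime) (hnd : l.Nodup) : derivFamilyList l γ = derivFamilyList l' γ := by
  induction h with
  | nil => rfl
  | cons x _ ih =>
    rename_i l₁ l₂ hperm
    simp only [derivFamilyList_cons]
    rw [ih (fun q hq ↦ hp q (List.mem_cons_of_mem x hq)) (List.Nodup.of_cons hnd)]
  | swap x y l =>
    simp only [derivFamilyList_cons]
    have hx : x.Prime := hp x (List.mem_cons_of_mem y List.mem_cons_self)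
    have hy : y.Prime := hp y List.mem_cons_self
    have hne : y ≠ x := by
      intro hxy
      have := (List.nodup_cons.mp hnd).1
      exact this (hxy ▸ List.mem_cons_self)
    have hper : IsPeriodic (derivFamilyList l γ) :=
      hγ.derivFamilyList l fun q hq ↦
        (hp q (List.mem_cons_of_mem y (List.mem_cons_of_mem x hq))).pos
    funext r
    exact (heckeDeriv_comm hper hy hx hne r)
  | trans h₁ _ ih₁ ih₂ =>
    rename_i l₁ l₂ l₃ h₂
    rw [ih₁ hp hnd, ih₂ (fun q hq ↦ hp q (h₁.mem_iff.mpr hq)) (h₁.nodup_iff.mp hnd)]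

/-! ### §2 The family on finite sets -/

/-- **The derivative family generated by `γ`**: `d_U γ := (∏_{q ∈ U} d_q) γ`, realised along the
sorted list of `U` (order-independent by `derivFamilyList_perm`). [cite: MazurTateTeitelbaum1986Invent, §I.4 (4.2)] -/
def derivFamily (γ : ℚ → R) (U : Finset ℕ) : ℚ → R :=
  derivFamilyList (U.sort (· ≤ ·)) γ

/-- `d_∅ γ = γ`. [folklore] -/
theorem derivFamily_empty (γ : ℚ → R) : derivFamily γ ∅ = γ := by
  simp [derivFamily, derivFamilyList]

/-- Periodicity of `d_U γ`. [folklore] -/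
theorem IsPeriodic.derivFamily {γ : ℚ → R} (hγ : IsPeriodic γ) {U : Finset ℕ}
    (hU : ∀ q ∈ U, q.Prime) : IsPeriodic (derivFamily γ U) :=
  hγ.derivFamilyList _ fun q hq ↦ (hU q ((Finset.mem_sort _).mp hq)).pos

/-- **`d_{U ∪ {q}} γ = d_q (d_U γ)`** for a prime `q ∉ U`, `U` a set of primes, `γ` periodic. [folklore] -/
theorem derivFamily_insert {γ : ℚ → R} (hγ : IsPeriodic γ) {U : Finset ℕ} (hU : ∀ q ∈ U, q.Prime)
    {q : ℕ} (hq : q.Prime) (hqU : q ∉ U) :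
    derivFamily γ (insert q U) = heckeDeriv q (derivFamily γ U) := by
  unfold derivFamily
  rw [← derivFamilyList_cons]
  have hperm : ((insert q U).sort (· ≤ ·)).Perm (q :: U.sort (· ≤ ·)) := by
    apply List.perm_of_nodup_nodup_toFinset_eq (Finset.sort_nodup _ _)
    · exact List.nodup_cons.mpr ⟨by simpa using hqU, Finset.sort_nodup _ _⟩
    · ext x
      simp
  refine derivFamilyList_perm hγ hperm ?_ (Finset.sort_nodup _ _)
  intro x hx
  rcases Finset.mem_insert.mp ((Finset.mem_sort _).mp hx) with rfl | hx'
  exacts [hq, hU x hx']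

/-- **THE DERIVATIVE-FAMILY RELATION** `H_q (d_U γ) = 2·d_U γ + d_{U ∪ {q}} γ` for a prime `q ∉ U`, `U`
a set of primes and `γ` periodic — the shape of the hypotheses `hD` / `hDG` of
`X4/KuriharaLevelLoweringDescentDefect.lean` and `X4/KuriharaAdditiveLevelLowering.lean`. [folklore] -/
theorem heckeTransform_derivFamily {γ : ℚ → R} (hγ : IsPeriodic γ) {U : Finset ℕ}
    (hU : ∀ q ∈ U, q.Prime) {q : ℕ} (hq : q.Prime) (hqU : q ∉ U) (r : ℚ) :
    heckeTransform q (derivFamily γ U) r =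
      2 * derivFamily γ U r + derivFamily γ (insert q U) r := by
  rw [derivFamily_insert hγ hU hq hqU, heckeTransform_eq_two_mul_add_heckeDeriv]

/-! ### §3 Linearity in `γ` -/

/-- `d_q` is additive. [folklore] -/
theorem heckeDeriv_add (q : ℕ) (μ ν : ℚ → R) :
    heckeDeriv q (fun x ↦ μ x + ν x) = fun x ↦ heckeDeriv q μ x + heckeDeriv q ν x := by
  funext r
  simp only [heckeDeriv, heckeTransform_add]
  ring

/-- `d_q` commutes with scalars. [folklore] -/
theorem heckeDeriv_const_mul (q : ℕ) (c : R) (μ : ℚ → R) :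
    heckeDeriv q (fun x ↦ c * μ x) = fun x ↦ c * heckeDeriv q μ x := by
  funext r
  simp only [heckeDeriv, heckeTransform_const_mul]
  ring

/-- `d_l (μ + ν) = d_l μ + d_l ν` along a list. [folklore] -/
theorem derivFamilyList_add (μ ν : ℚ → R) :
    ∀ l : List ℕ, derivFamilyList l (fun x ↦ μ x + ν x) =
      fun x ↦ derivFamilyList l μ x + derivFamilyList l ν x
  | [] => rfl
  | q :: l => by
    simp only [derivFamilyList_cons]
    rw [derivFamilyList_add μ ν l, heckeDeriv_add]

/-- `d_l (c·μ) = c·d_l μ` along a list. [folklore] -/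
theorem derivFamilyList_const_mul (c : R) (μ : ℚ → R) :
    ∀ l : List ℕ, derivFamilyList l (fun x ↦ c * μ x) = fun x ↦ c * derivFamilyList l μ x
  | [] => rfl
  | q :: l => by
    simp only [derivFamilyList_cons]
    rw [derivFamilyList_const_mul c μ l, heckeDeriv_const_mul]

/-- **Linearity of the derivative family in `γ`**: `d_U (μ + ν) = d_U μ + d_U ν`. [folklore] -/
theorem derivFamily_add (μ ν : ℚ → R) (U : Finset ℕ) :
    derivFamily (fun x ↦ μ x + ν x) U = fun x ↦ derivFamily μ U x + derivFamily ν U x :=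
  derivFamilyList_add μ ν _

/-- `d_U (c·μ) = c·d_U μ`. [folklore] -/
theorem derivFamily_const_mul (c : R) (μ : ℚ → R) (U : Finset ℕ) :
    derivFamily (fun x ↦ c * μ x) U = fun x ↦ c * derivFamily μ U x :=
  derivFamilyList_const_mul c μ _

/-- `d_U (μ − ν) = d_U μ − d_U ν`. [folklore] -/
theorem derivFamily_sub (μ ν : ℚ → R) (U : Finset ℕ) :
    derivFamily (fun x ↦ μ x - ν x) U = fun x ↦ derivFamily μ U x - derivFamily ν U x := by
  have h1 : (fun x ↦ μ x - ν x) = fun x ↦ μ x + (fun y ↦ (-1 : R) * ν y) x := by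
    funext x; simp; ring
  rw [h1, derivFamily_add, derivFamily_const_mul]
  funext x
  ring

/-- `d_U` of a finite sum of functions. [folklore] -/
theorem derivFamily_sum {ι : Type*} (s : Finset ι) (g : ι → ℚ → R) (U : Finset ℕ) :
    derivFamily (fun x ↦ ∑ i ∈ s, g i x) U = fun x ↦ ∑ i ∈ s, derivFamily (g i) U x := by
  classical
  induction s using Finset.induction_on with
  | empty =>
    funext x
    simp only [Finset.sum_empty]
    have : (fun _ : ℚ ↦ (0 : R)) = fun x ↦ (0 : R) * (0 : R) := by funext; simp
    rw [this, derivFamily_const_mul]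
    simp
  | insert a s has ih =>
    funext x
    simp only [Finset.sum_insert has]
    have : (fun x ↦ g a x + ∑ i ∈ s, g i x) = fun x ↦ g a x + (fun y ↦ ∑ i ∈ s, g i y) x := rfl
    rw [this, derivFamily_add]
    simp only
    rw [ih]

end Summit.BirchSwinnertonDyer.Rank1Residual.LevelLowering

end
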